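import Literature.Geometry.Riemannian.GurskyViaclovskyClosednessEllipticity
import Literature.Geometry.Lorentzian.WeylConformal
import HarnessLib

/-!
# Gursky–Viaclovsky closedness: naturality of the background operator under equidimensional
# isometric immersions (the first step of the chart form of the equation)

Support file (everything PROVED; no definition, no named fact) for the named fact
`Literature.Geometry.Riemannian.gurskyViaclovsky_pathClosed_weighted_four`. To run the elliptic
estimates of Gursky–Viaclovsky's Prop. 6 in a chart one reads the background equation
`backgroundPathOperator g t w = q e^{−4w}` through the inverse chart `Φ = (chartAt c)⁻¹`, i.e. on
the open subset `U = (chartAt c).target` of `ℝ⁴` with the pulled-back metric `Φ^*g = g.comap …`.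
This file proves that nothing changes:

* `backgroundScalar_comap`, `backgroundPathOperator_comap` — for an equidimensional immersion
  `Φ : N → M` of `4`-manifolds and a Riemannian `g` on `M`,
  `backgroundScalar (Φ^*g) (w ∘ Φ) y = backgroundScalar g w (Φ y)` and
  `backgroundPathOperator (Φ^*g) t (w ∘ Φ) y = backgroundPathOperator g t w (Φ y)`:
  both sides are the frame polynomial `𝒫_t` (`backgroundPathOperator_eq_framePoly`) of frame
  data which correspond under `dΦ_y` — a `g`-orthonormal frame `b` at `Φ y` pulls back to a
  `Φ^*g`-orthonormal frame `e` at `y` with `dΦ e_a = b_a`, and Ricci, scalar curvature, `|W|²`,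
  covariant Hessians and differentials are natural (`ricci_comap_apply_cn`,
  `scalarCurvature_comap_cn`, `weylNormSq_comap`, `hessian_comap_apply`, `mvfderiv_comp_apply`).

## References

* M. J. Gursky, J. A. Viaclovsky, J. Differential Geom. 63 (2003) 131–154, §1, Prop. 6.
  [GurskyViaclovsky2003]
* B. O'Neill, *Semi-Riemannian Geometry* (1983), Ch. 3, pp. 90–91 (isometries preserve
  curvature). [ONeill1983]
-/

noncomputable section

open scoped Manifold ContDiff Topology
open Set Function Module Finset

namespace Literature.Geometry.Riemannian.GurskyViaclovskyPath

open Literature.Geometry.Lorentzian (PseudoRiemannianMetric)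
open Literature.Geometry.Lorentzian.PseudoRiemannianMetric
open Literature.Geometry.Lorentzian
open Literature.Geometry.Riemannian.GurskyViaclovsky

section Naturality

variable {M : Type*} [TopologicalSpace M] [ChartedSpace (EuclideanSpace ℝ (Fin 4)) M]
  [IsManifold (𝓡 4) ∞ M]
  {N : Type*} [TopologicalSpace N] [ChartedSpace (EuclideanSpace ℝ (Fin 4)) N]
  [IsManifold (𝓡 4) ∞ N]
  (g : PseudoRiemannianMetric (𝓡 4) ∞ (EuclideanSpace ℝ (Fin 4)) (TangentSpace (𝓡 4) : M → Type _))
  [g.HasLeviCivita]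
  {Φ : N → M} (hpb : contMDiff_pullbackBilin (𝓡 4) M (𝓡 4) N ∞)
  (hΦ : ContMDiff (𝓡 4) (𝓡 4) (∞ + 1) Φ)
  (hΦ' : ∀ y, Function.Injective (mfderiv (𝓡 4) (𝓡 4) Φ y))
  (hdim : finrank ℝ (EuclideanSpace ℝ (Fin 4)) = finrank ℝ (EuclideanSpace ℝ (Fin 4)))
  [(g.comap hpb Φ hΦ hΦ' hdim).HasLeviCivita]

/-- **Naturality of the background scalar**: `backgroundScalar (Φ^*g) (w ∘ Φ) y =
backgroundScalar g w (Φ y)` (`= e^{2w}R_{e^{2w}g}`; scalar curvature, d'Alembertian and gradient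
square are natural). [cite: ONeill1983, Ch. 3, pp. 90–91] -/
theorem backgroundScalar_comap (hg : g.IsRiemannian) {w : M → ℝ}
    (hw : ContMDiff (𝓡 4) 𝓘(ℝ) ∞ w) (y : N) :
    backgroundScalar (g.comap hpb Φ hΦ hΦ' hdim) (w ∘ Φ) y = backgroundScalar g w (Φ y) := by
  have hE : finrank ℝ (EuclideanSpace ℝ (Fin 4)) = 4 := finrank_euclideanSpace_fin
  have hn : (2 : ℕ∞ω) ≤ ((⊤ : ℕ∞) : ℕ∞ω) := WithTop.coe_le_coe.mpr le_top
  have hinv := isInvertible_mfderiv_of_injective (Φ := Φ) hdim (hΦ' y)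
  obtain ⟨b, hb⟩ := g.exists_basis_isOrthonormalFrame (x := Φ y) (fun v hv ↦ hg _ v hv) hE
  set e : Fin 4 → TangentSpace (𝓡 4) y := fun i ↦ (mfderiv (𝓡 4) (𝓡 4) Φ y).inverse (b i)
    with he_def
  have hde : ∀ i, mfderiv (𝓡 4) (𝓡 4) Φ y (e i) = b i := fun i ↦ hinv.self_apply_inverse (b i)
  have he : (g.comap hpb Φ hΦ hΦ' hdim).IsOrthonormalFrame y e := by
    rw [g.isOrthonormalFrame_comap_iff hpb hΦ hΦ' hdim]
    simp only [hde]
    exact hb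
  have hwΦ : ContMDiff (𝓡 4) 𝓘(ℝ) ∞ (w ∘ Φ) := hw.comp (hΦ.of_le le_self_add)
  have hw2 : ContMDiffAt (𝓡 4) 𝓘(ℝ) 2 w (Φ y) := (hw.of_le hn) _
  have hwd : MDifferentiableAt (𝓡 4) 𝓘(ℝ, ℝ) w (Φ y) := hw2.mdifferentiableAt (by simp)
  have hΦd : MDifferentiableAt (𝓡 4) (𝓡 4) Φ y :=
    ((hΦ.of_le le_self_add) y).mdifferentiableAt (by simp)
  have hHess : ∀ a c, (g.comap hpb Φ hΦ hΦ' hdim).hessian (w ∘ Φ) y (e a) (e c) =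
      g.hessian w (Φ y) (b a) (b c) := fun a c ↦ by
    rw [g.hessian_comap_apply hpb hΦ hΦ' hdim hw2 (e a) (e c), hde, hde]
  have hd : ∀ a, mvfderiv (𝓡 4) (w ∘ Φ) y (e a) = mvfderiv (𝓡 4) w (Φ y) (b a) := fun a ↦ by
    rw [mvfderiv_comp_apply hwd hΦd, hde]
  rw [backgroundScalar_eq_frame _ (w ∘ Φ) he, backgroundScalar_eq_frame g w hb,
    g.scalarCurvature_comap_cn hpb hΦ hΦ' hdim hn y]
  simp only [hHess, hd]

/-- **Naturality of the background operator**: `backgroundPathOperator (Φ^*g) t (w ∘ Φ) y =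
backgroundPathOperator g t w (Φ y)` for an equidimensional immersion `Φ` of `4`-manifolds and a
Riemannian `g` — both sides are the frame polynomial `𝒫_t` of corresponding frame data
(`backgroundPathOperator_eq_framePoly`; Ricci, scalar curvature, `|W|²`, Hessians and
differentials are natural). In particular the background equation read through the inverse chart
`(chartAt c)⁻¹` on `(chartAt c).target ⊆ ℝ⁴` is the same equation for the pulled-back metric.
[cite: ONeill1983, Ch. 3, pp. 90–91] -/
theorem backgroundPathOperator_comap (hg : g.IsRiemannian) {w : M → ℝ}
    (hw : ContMDiff (𝓡 4) 𝓘(ℝ) ∞ w) (t : ℝ) (y : N) :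
    backgroundPathOperator (g.comap hpb Φ hΦ hΦ' hdim) t (w ∘ Φ) y =
      backgroundPathOperator g t w (Φ y) := by
  have hE : finrank ℝ (EuclideanSpace ℝ (Fin 4)) = 4 := finrank_euclideanSpace_fin
  have hn : (2 : ℕ∞ω) ≤ ((⊤ : ℕ∞) : ℕ∞ω) := WithTop.coe_le_coe.mpr le_top
  have hinv := isInvertible_mfderiv_of_injective (Φ := Φ) hdim (hΦ' y)
  obtain ⟨b, hb⟩ := g.exists_basis_isOrthonormalFrame (x := Φ y) (fun v hv ↦ hg _ v hv) hE
  set e : Fin 4 → TangentSpace (𝓡 4) y := fun i ↦ (mfderiv (𝓡 4) (𝓡 4) Φ y).inverse (b i)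
    with he_def
  have hde : ∀ i, mfderiv (𝓡 4) (𝓡 4) Φ y (e i) = b i := fun i ↦ hinv.self_apply_inverse (b i)
  have he : (g.comap hpb Φ hΦ hΦ' hdim).IsOrthonormalFrame y e := by
    rw [g.isOrthonormalFrame_comap_iff hpb hΦ hΦ' hdim]
    simp only [hde]
    exact hb
  have hwΦ : ContMDiff (𝓡 4) 𝓘(ℝ) ∞ (w ∘ Φ) := hw.comp (hΦ.of_le le_self_add)
  have hw2 : ContMDiffAt (𝓡 4) 𝓘(ℝ) 2 w (Φ y) := (hw.of_le hn) _
  have hwd : MDifferentiableAt (𝓡 4) 𝓘(ℝ, ℝ) w (Φ y) := hw2.mdifferentiableAt (by simp)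
  have hΦd : MDifferentiableAt (𝓡 4) (𝓡 4) Φ y :=
    ((hΦ.of_le le_self_add) y).mdifferentiableAt (by simp)
  have hRic : ∀ a c, (g.comap hpb Φ hΦ hΦ' hdim).ricci y (e a) (e c) =
      g.ricci (Φ y) (b a) (b c) := fun a c ↦ by
    rw [g.ricci_comap_apply_cn hpb hΦ hΦ' hdim hn y (e a) (e c), hde, hde]
  have hHess : ∀ a c, (g.comap hpb Φ hΦ hΦ' hdim).hessian (w ∘ Φ) y (e a) (e c) =
      g.hessian w (Φ y) (b a) (b c) := fun a c ↦ by
    rw [g.hessian_comap_apply hpb hΦ hΦ' hdim hw2 (e a) (e c), hde, hde]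
  have hd : ∀ a, mvfderiv (𝓡 4) (w ∘ Φ) y (e a) = mvfderiv (𝓡 4) w (Φ y) (b a) := fun a ↦ by
    rw [mvfderiv_comp_apply hwd hΦd, hde]
  -- the pull-back metric is Riemannian (`IsRiemannian.comap` of the curvature-smoothing file,
  -- re-proved inline to keep that development out of this file's closure)
  have hg' : (g.comap hpb Φ hΦ hΦ' hdim).IsRiemannian := fun u v hv ↦ by
    rw [val_comap, pullbackBilin_apply]
    exact hg _ _ fun h0 ↦ hv ((hΦ' u) (by
      rw [h0]; exact ((mfderiv (𝓡 4) (𝓡 4) Φ u).map_zero).symm))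
  rw [backgroundPathOperator_eq_framePoly _ hwΦ t he, backgroundPathOperator_eq_framePoly g hw t hb,
    sigma2WeylSchouten_eq_sigma2_frame _ hg' he, sigma2WeylSchouten_eq_sigma2_frame g hg hb,
    g.scalarCurvature_comap_cn hpb hΦ hΦ' hdim hn y, g.weylNormSq_comap hpb hΦ hΦ' hdim hg y]
  simp only [hRic, hHess, hd]

end Naturality

end Literature.Geometry.Riemannian.GurskyViaclovskyPath

end
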